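import Literature.AlgebraicTopology.SingularHomology.GysinMapSupportProofs
import Literature.AlgebraicGeometry.HodgeTheory.ComplexGysin
import Literature.AlgebraicGeometry.Motives.ComplexPointsManifold

/-!
# Stub `stub_vanishesOffImage` (S2a; line `purity-sorted-hecke-envelope` / `HeckeGraphChow` of crux
# `EndoscopicMiddleDegree.OrthogonalEnveloped`, stmt-HodgeConjecture-14300): the Poincaré dual of a
# class pushed forward from `L` dies off the image of `L`

Registered skeleton: `HeckeGraphChow` of crux `OrthogonalEnveloped`; this is the file
`Theorems/EndoscopicMiddleDegreeOrthogonalEnvelopedVanishesOffImage.lean` of the summit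
(`--supports stmt-HodgeConjecture-14300`).

WHAT IS PROVED. The topological half of "the Hecke graph class is supported on the image of the
Hecke graph":

* `map_compl_eq_zero_of_capProduct_fundamentalClass_eq_map` — **general form, any field `F` of
  coefficients**: for a closed `F`-oriented topological `n`-manifold `X`
  (`μ : HomologicalOrientation F X n`), ANY space `L` with a continuous `f : L → X`, any subset
  `K ⊇ f(L)` of `X` (not necessarily closed), and classes `x ∈ Hᵖ(X; F)`, `β ∈ H_q(L; F)`
  (`p + q = n`) with `x ⌢ [X] = f_* β`: the restriction of `x` to the subspace `X ∖ K` vanishes.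
  Proof — the Čech–Poincaré argument of the tree's `gysinMap_restrictCompl_eq_zero_of_field`
  (`SingularHomology/GysinMapSupportProofs`) with the step "`y ⌢ [Y]` is carried by `Y ∖ f⁻¹C`"
  replaced by the trivial fact that `f_* β` is carried by `X ∖ C` for every `C ⊆ X ∖ K` (since `f`
  factors through `X ∖ C`): over a field `x|_U = 0` iff `⟨x|_U, σ⟩ = 0` for all `σ ∈ H_p(U; F)`
  (`kroneckerPairing_injective_of_field`); `σ` is carried by a compact `C₀ ⊆ U`
  (`singularHomology.exists_isCompact_mem_range_map`) whose image `C ⊆ X` is compact, hence closed,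
  and disjoint from `K`; `j_*(x ⌢ [X]) = j_*(f_* β) = 0 ∈ H_q(X, X ∖ C)` (`map_comp_ofAbsolute`), so
  `x` dies on an open `V ⊇ C` by Čech–Poincaré duality along `C`
  (`exists_isOpen_map_eq_zero_of_ofAbsolute_capProduct_eq_zero`), and
  `⟨x|_U, σ⟩ = ⟨x|_V, σ_V⟩ = 0` (`kroneckerPairing_map`). No Poincaré-duality hypothesis is needed
  (Čech duality along closed subsets of a closed oriented manifold is proved in the tree).
* `stub_vanishesOffImage` — the registered stub: the case `X = Y(ℂ)` for `Y` smooth projective over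
  `ℂ` of dimension `n` (a closed `2n`-manifold: `IsSmoothProjective.chartedSpace`,
  `ComplexPoints.compactSpace_of_isSmoothProjective`, `ComplexPoints.t2Space_of_isSmoothProjective`),
  `F = ℂ`, the orientation `μ hY` of an orientation family `μ`, and `K = F(L)`.

Sources: W. Fulton, *Young Tableaux* (1997), App. B §B.2 Exercise 5 (proper push-forward commutes
with restriction to open subsets, support form); A. Hatcher, *Algebraic Topology* (2002), §3.1
Thm. 3.2 (p. 198), §3.3 Thm. 3.44; H. Miller, *Lectures on Algebraic Topology* (2020), Thm. 37.1.
-/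

noncomputable section

-- The crux-workfile namespace `Summit.<P>.<Sub>.Cruxes.…` repeats `HodgeConjecture` (single-conjunct summit).
set_option linter.dupNamespace false

universe u v

namespace Summit.HodgeConjecture.HodgeConjecture.Cruxes.OrthogonalEnveloped.HeckeGraphChow

open Literature.AlgebraicGeometry.Motives (SchemeOver ComplexPoints IsSmoothProjective)
open Literature.AlgebraicGeometry.HodgeTheory
open Literature.AlgebraicTopology.SingularHomology

/-! ## Helper (worker): the general topological statement over a field -/

/-- **The Poincaré dual of a pushed-forward class dies off the image — closed oriented manifolds,
field coefficients.** For a closed `F`-oriented topological `n`-manifold `X` (`F` a field), a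
continuous `f : L → X` from ANY space `L`, a subset `K ⊇ f(L)` of `X`, and classes
`x ∈ Hᵖ(X; F)`, `β ∈ H_q(L; F)` (`p + q = n`) with `x ⌢ [X] = f_* β`, the restriction of `x` to the
subspace `{x' ∈ X | x' ∉ K}` vanishes. Proof: over a field it suffices to pair `x|_{X ∖ K}` with
every `σ ∈ H_p(X ∖ K; F)` (`kroneckerPairing_injective_of_field`, Hatcher Thm. 3.2 / p. 198); `σ`
is carried by a compact `C₀`, whose image `C ⊆ X` is closed and disjoint from `K ⊇ f(L)`, so `f`
factors through `X ∖ C` and `j_*(x ⌢ [X]) = j_*(f_* β) = 0 ∈ H_q(X, X ∖ C)`; by Čech–Poincaré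
duality along `C` (`exists_isOpen_map_eq_zero_of_ofAbsolute_capProduct_eq_zero`, Hatcher Thm. 3.44 /
Miller Thm. 37.1) `x` dies on an open `V ⊇ C`, and `⟨x|_{X ∖ K}, σ⟩ = ⟨x|_V, σ_V⟩ = 0` by
naturality of the Kronecker pairing. This is Fulton's compatibility of proper push-forward with
restriction to open subsets (Young Tableaux App. B §B.2 Exercise 5) in the degenerate case where the
restricted map has empty source.
[cite: FultonYoungTableaux1997, Appendix B §B.2 Exercise 5]
[cite: HatcherAT2002, §3.1 Thm. 3.2 (p. 198) and §3.3 Thm. 3.44] [cite: Miller2020, Thm. 37.1] -/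
theorem map_compl_eq_zero_of_capProduct_fundamentalClass_eq_map {F : Type v} [Field F] {n : ℕ}
    {X : Type u} [TopologicalSpace X] [T2Space X] [CompactSpace X]
    [ChartedSpace (EuclideanSpace ℝ (Fin n)) X] (μ : HomologicalOrientation F X n)
    {L : Type u} [TopologicalSpace L] (f : C(L, X)) {K : Set X} (hK : Set.range f ⊆ K)
    {p q : ℕ} (h : p + q = n) (x : singularCohomology F F X p) (β : singularHomology F F L q)
    (hx : capProduct h x μ.fundamentalClass = singularHomology.map F F f q β) :
    singularCohomology.map F F
      (⟨Subtype.val, continuous_subtype_val⟩ : C({x' : X // x' ∉ K}, X)) p x = 0 := by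
  -- over a field it suffices to pair with every homology class `σ` of `U = X ∖ K`
  apply kroneckerPairing_injective_of_field F _ p
  rw [map_zero]
  refine LinearMap.ext fun σ => ?_
  rw [LinearMap.zero_apply]
  -- `σ` is carried by a compact `C₀ ⊆ U`; its image `C ⊆ X ∖ K` is compact, hence closed
  obtain ⟨C₀, hC₀, τ, rfl⟩ := singularHomology.exists_isCompact_mem_range_map F F σ
  set C : Set X := Subtype.val '' C₀
  have hCcl : IsClosed C := (hC₀.image continuous_subtype_val).isClosed
  have hCK : C ⊆ Kᶜ := by
    rintro _ ⟨z, _, rfl⟩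
    exact z.2
  -- `x ⌢ [X] = f_* β` is carried by `X ∖ C`, since `f` factors through `X ∖ C ⊇ K ⊇ f(L)`
  have hz : relativeSingularHomology.ofAbsolute F F X Cᶜ q (capProduct h x μ.fundamentalClass) = 0 := by
    let f' : C(L, ↥Cᶜ) := ⟨fun l => ⟨f l, fun hl => hCK hl (hK ⟨l, rfl⟩)⟩, by fun_prop⟩
    have e : f = (⟨Subtype.val, continuous_subtype_val⟩ : C(↥Cᶜ, X)).comp f' := by
      ext l
      rfl
    have e' : singularHomology.map F F f q β =
        singularHomology.map F F (⟨Subtype.val, continuous_subtype_val⟩ : C(↥Cᶜ, X)) q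
          (singularHomology.map F F f' q β) := by
      rw [← ModuleCat.comp_apply, ← singularHomology.map_comp, ← e]
    rw [hx, e', ← ModuleCat.comp_apply, relativeSingularHomology.map_comp_ofAbsolute]
    rfl
  -- so `x` vanishes on an open neighbourhood `V` of `C`
  obtain ⟨V, -, hCV, hxV⟩ :=
    exists_isOpen_map_eq_zero_of_ofAbsolute_capProduct_eq_zero μ hCcl h x hz
  -- and `⟨x|_U, σ⟩ = ⟨x|_V, σ'⟩ = 0` for the lift `σ'` of `σ` to `V ⊇ C₀`
  let g : C(↥C₀, ↥V) := ⟨fun z => ⟨z.1.1, hCV ⟨z.1, z.2, rfl⟩⟩, by fun_prop⟩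
  have e2 : (⟨Subtype.val, continuous_subtype_val⟩ : C({x' : X // x' ∉ K}, X)).comp
      (⟨Subtype.val, continuous_subtype_val⟩ : C(↥C₀, {x' : X // x' ∉ K})) =
        (⟨Subtype.val, continuous_subtype_val⟩ : C(↥V, X)).comp g := by
    ext z
    rfl
  rw [kroneckerPairing_map, ← ModuleCat.comp_apply, ← singularHomology.map_comp, e2,
    singularHomology.map_comp, ModuleCat.comp_apply, ← kroneckerPairing_map, hxV, map_zero,
    LinearMap.zero_apply]

/-! ## The registered stub -/

/-- **Stub S2a — the Poincaré dual of a class pushed forward from `L` dies off the image of `L`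
(KNOWN: Fulton, Young Tableaux App. B Ex. 5 / Bredon V.10, here in the elementary Čech form of the
tree's `gysinMap_restrictCompl_eq_zero_of_field`; M).** For `μ` with Poincaré duality, `Y` smooth
projective of dimension `n`, any `F : L → Y(ℂ)`, `θ ∈ H_q(L; ℂ)` and `γ ∈ Hᵇ(Y(ℂ); ℂ)` (`b + q = 2n`)
with `γ ⌢ [Y(ℂ)] = F_* θ`: `γ` restricts to `0` on `{P ∈ Y(ℂ) | P ∉ F(L)}`. Proof: pair with a
homology class `σ` of the complement, carried by a compact `C ⊆ Y(ℂ) ∖ F(L)`; `F_* θ` is carried by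
`Y(ℂ) ∖ C` (F factors through it), so `γ` dies near `C` by Čech–Poincaré duality along `C`
(`exists_isOpen_map_eq_zero_of_ofAbsolute_capProduct_eq_zero`), and `⟨γ|, σ⟩ = 0`
(`kroneckerPairing_injective_of_field`) — the case `X = Y(ℂ)`, `K = F(L)` of
`map_compl_eq_zero_of_capProduct_fundamentalClass_eq_map` (the Poincaré-duality hypothesis is not
used). [cite: FultonYoungTableaux1997, Appendix B §B.2 Exercise 5]
[cite: HatcherAT2002, §3.3 Thm. 3.44 and §3.1 Thm. 3.2] -/
theorem stub_vanishesOffImage :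
    ∀ (μ : OrientationFamily), μ.HasPoincareDuality →
      ∀ (n : ℕ) (Y : SchemeOver ℂ) (hY : IsSmoothProjective n Y)
        (L : Type) [TopologicalSpace L] (F : C(L, ComplexPoints Y))
        (b q : ℕ) (hb : b + q = 2 * n) (θ : singularHomology ℂ ℂ L q) (γ : complexBetti Y b),
        capProduct hb γ (μ hY).fundamentalClass = singularHomology.map ℂ ℂ F q θ →
        singularCohomology.map ℂ ℂ
          (⟨Subtype.val, continuous_subtype_val⟩ :
            C({P : ComplexPoints Y // P ∉ Set.range F}, ComplexPoints Y)) b γ = 0 := by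
  intro μ _ n Y hY L _ F b q hb θ γ hγ
  letI := hY.chartedSpace
  haveI := Literature.AlgebraicGeometry.Motives.ComplexPoints.compactSpace_of_isSmoothProjective hY
  haveI := Literature.AlgebraicGeometry.Motives.ComplexPoints.t2Space_of_isSmoothProjective hY
  exact map_compl_eq_zero_of_capProduct_fundamentalClass_eq_map (μ hY) F subset_rfl hb γ θ hγ

end Summit.HodgeConjecture.HodgeConjecture.Cruxes.OrthogonalEnveloped.HeckeGraphChow

end
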